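import Literature.AnabelianGeometry.AbsoluteAnabelian.LogShellsOfUnitLog
import HarnessLib

/-!
# L-LANA objects III bis: the holomorphic Frobenius-like log-shell `(HF)` `I_v = (2p_v)⁻¹·log(O^×_v)` is REAL, with `O_v ⊂ I_v` (LANA §5.1; N10 (HF) RESOLVED)

Record-only file (D-0012) of the abc-iut cell (seat abc-iut-c312-4, L-LANA level, plan/LLANA-SPEC N10 "(HF)/(MF)
DEFINE; (HE)/(ME) DEFINE over N9"); TAKES NO SIDE on [IUTchIII] Cor. 3.12. LANA §5.1 p. 26, read on the page:
"the `p`-adic logarithm map gives an isomorphism of groups `log : Ō^{×μ}_v ⥲ K̄_v`. Using this, we define a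
`ℤ_p`-module `I_v`, called the log-shell at `v`, by `I_v = (2p_v)⁻¹ · Im(O^×_v ↪ Ō^×_v ↠ Ō^{×μ}_v →^{log} K̄_v) ⊂ K̄_v`;
note that the factor `(2p_v)⁻¹` makes the inclusion `O_v ⊂ I_v` to hold"; §5.1 (a) p. 27: the holomorphic
Frobenius-like version `(HF)` is "`I_v(F) = (2p_v)⁻¹ · Im(O^×_v(F) ↪ Ō^×_v(F) ↠ K̄_v(log F))`, where
`O^×_v(F) = (Ō^×_v(F))^{Π_v(F)}`" (the invariants, i.e. the units of `K_v`). Gen-0's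
`LanaLogShell.lean` typed only the mono-analytic shells `(MF)/(ME)` (as root sets inside `O^{×μ}`) and left
`(HF)` to the `p`-adic logarithm of campaign S. That logarithm is now in the tree: abc-iut-S1's
`Literature.IUT.LogVolume.unitLog = log_p` on the units `{‖u‖ = 1}` of a complete ultrametric normed
`ℚ_p`-algebra field `K_v` (`LocalUnitLog.lean`), merged by abc-iut-L3-t11 into [AbsTopIII] Def. 5.4 (iii)'s
log-shell `ℐ = (p*)⁻¹·log_p(𝒪^×)` with `𝒪_k ⊆ ℐ` PROVED (`LogShellsOfUnitLog.lean`,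
`closedBall_subset_logShell_ofUnitLog`). THIS FILE states LANA's `(HF)` shell over it, in LANA's normalisation:

* `logShellHF p K_v := (2p_v)⁻¹ • log_p(O^×_{K_v}) ⊆ K_v` — the `(HF)` log-shell at the level of the
  `G_v`-invariants (`O^×_v` without overline = `O^×_{K_v}`, §3.9);
* `unitLog_torsion` — "`O^×_v → O^{×μ}_v →^{log}`": `log_p` kills `O^μ_v` (roots of unity), so the printed map
  factors through `O^{×μ}_v = O^×_v/O^μ_v` (S1 `unitLog_eq_zero_of_pow_eq_one`);
* `logShell_ofUnitLog_subset_logShellHF` — Mochizuki's `ℐ = (p*)⁻¹·log_p(𝒪^×)` (`p* = p` resp. `4`) lies in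
  LANA's `(2p)⁻¹·log_p(𝒪^×)` (`(p*)⁻¹·log x = (2p)⁻¹·log(x^{2p/p*})`); for `p = 2` the two coincide
  (`logShellHF_two_eq`);
* `closedBall_subset_logShellHF` — **"`O_v ⊂ I_v`" (p. 26) PROVED** for the real logarithm.

Setting: `K_v` a nontrivially normed field, normed `ℚ_p`-algebra, ultrametric, complete and proper (every
finite extension of `ℚ_p`, e.g. the completions of a number field). [cite: LANA2026Report, §5.1 pp. 26–27]
[cite: MochizukiAbsTopIII2015, Def 5.4 (iii) p. 126] NOT here: `(HE)` (anabelian, N9), the upper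
semi-compatibility (Ind3), the passage to `K̄_v` / `VC(I)` (N11), any judgement.
-/

noncomputable section

open Set Metric
open scoped Pointwise
open Literature.IUT.LogVolume Literature.AnabelianGeometry.AbsoluteAnabelian

namespace Summit.ABC
namespace IUTFork

variable (p : ℕ) [hp : Fact p.Prime]
variable (K : Type) [NontriviallyNormedField K]

/-- **LANA's holomorphic Frobenius-like log-shell `(HF)`** at the level of `K_v`:
`I_v := (2p_v)⁻¹ · log_p(O^×_{K_v}) ⊆ K_v` ("`I_v = (2p_v)⁻¹ · Im(O^×_v → O^{×μ}_v →^{log} K̄_v)`", the image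
of the units of `K_v`; S1's `logUnits K = log_p({‖u‖ = 1})`). [cite: LANA2026Report, §5.1 p. 26] -/
def logShellHF : Set K := (((2 * p : ℕ) : K))⁻¹ • logUnits K

omit hp in
/-- Membership in `I_v`: `y ∈ I_v ⟺ y = (2p)⁻¹ · log_p u` for some unit `u`. [cite: LANA2026Report, §5.1 p. 26] -/
theorem mem_logShellHF_iff (y : K) :
    y ∈ logShellHF p K ↔ ∃ u : K, ‖u‖ = 1 ∧ (((2 * p : ℕ) : K))⁻¹ * unitLog u = y := by
  constructor
  · rintro ⟨z, hz, rfl⟩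
    obtain ⟨u, hu, rfl⟩ := (mem_logUnits_iff).mp hz
    exact ⟨u, hu, rfl⟩
  · rintro ⟨u, hu, rfl⟩
    exact ⟨unitLog u, unitLog_mem_logUnits hu, rfl⟩

omit hp in
/-- `2p = p* · (2p/p*)` with `p* = p^{1 or 2}` and `2p/p* = 2` (odd `p`) or `1` (`p = 2`). [folklore] -/
theorem two_mul_eq_pstarNat_mul : 2 * p = p ^ (if p = 2 then 2 else 1) * (if p = 2 then 1 else 2) := by
  split_ifs with h
  · subst h; norm_num
  · simp [mul_comm]

variable [instK : NormedAlgebra ℚ_[p] K] [IsUltrametricDist K] [CompleteSpace K]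
include instK

/-- For `p = 2`, LANA's `(2p)⁻¹` and Mochizuki's `(p*)⁻¹ = 4⁻¹` agree, so the `(HF)` shell IS [AbsTopIII]
Def. 5.4 (iii)'s log-shell of the real logarithm. [cite: LANA2026Report, §5.1 p. 26]
[cite: MochizukiAbsTopIII2015, Def 5.4 (iii) p. 126] -/
theorem logShellHF_two_eq (h : p = 2) : logShellHF p K = logShell (PadicLogOnUnits.ofUnitLog p K) := by
  subst h
  rw [logShell_ofUnitLog, logShellHF]
  norm_num

variable [ProperSpace K]

/-- **"`O^×_v → O^{×μ}_v →^{log} K̄_v`"**: the logarithm kills the torsion `O^μ_v ⊆ O^×_v` (roots of unity),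
so the printed arrow factors through `O^{×μ}_v = O^×_v/O^μ_v` — S1's `unitLog_eq_zero_of_pow_eq_one`.
[cite: LANA2026Report, §5.1 p. 26, §3.6 p. 20] -/
theorem unitLog_torsion {ζ : K} {n : ℕ} (hn : 0 < n) (h : ζ ^ n = 1) : unitLog ζ = 0 :=
  unitLog_eq_zero_of_pow_eq_one p hn h

/-- Consequently `log_p` takes the same value on `u` and `ζ·u` (`ζ ∈ O^μ_v`): the `(HF)` shell is the image
of `O^{×μ}_v`. [cite: LANA2026Report, §5.1 p. 26] -/
theorem unitLog_torsion_mul {ζ u : K} {n : ℕ} (hn : 0 < n) (h : ζ ^ n = 1) (hu : ‖u‖ = 1) :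
    unitLog (ζ * u) = unitLog u := by
  have hζ : ‖ζ‖ = 1 := by
    have h1 : ‖ζ‖ ^ n = 1 := by rw [← norm_pow, h, norm_one]
    exact (pow_eq_one_iff_of_nonneg (norm_nonneg ζ) hn.ne').mp h1
  rw [unitLog_mul p hζ hu, unitLog_torsion p K hn h, zero_add]

open Literature.NumberTheory.Transcendental in
/-- **Mochizuki's log-shell lies in LANA's**: `(p*)⁻¹ · log_p(𝒪^×_{K_v}) ⊆ (2p)⁻¹ · log_p(𝒪^×_{K_v})`, since
`(p*)⁻¹ · log_p(u) = (2p)⁻¹ · log_p(u^{2p/p*})` (`log_p` a homomorphism on units, S1 `unitLog_pow`).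
[cite: LANA2026Report, §5.1 p. 26] [cite: MochizukiAbsTopIII2015, Def 5.4 (iii) p. 126] -/
theorem logShell_ofUnitLog_subset_logShellHF :
    logShell (PadicLogOnUnits.ofUnitLog p K) ⊆ logShellHF p K := by
  rw [logShell_ofUnitLog]
  rintro _ ⟨z, hz, rfl⟩
  obtain ⟨u, hu, rfl⟩ := (mem_logUnits_iff).mp hz
  refine (mem_logShellHF_iff p K _).mpr ⟨u ^ (if p = 2 then 1 else 2), by rw [norm_pow, hu, one_pow], ?_⟩
  change (((2 * p : ℕ) : K))⁻¹ * unitLog (u ^ (if p = 2 then 1 else 2)) =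
    (((p ^ (if p = 2 then 2 else 1) : ℕ) : K))⁻¹ * unitLog u
  rw [unitLog_pow p hu]
  have hcast : ((2 * p : ℕ) : K) =
      ((p ^ (if p = 2 then 2 else 1) : ℕ) : K) * (((if p = 2 then 1 else 2 : ℕ)) : K) := by
    rw [two_mul_eq_pstarNat_mul p, Nat.cast_mul]
  have hmK : (((if p = 2 then 1 else 2 : ℕ)) : K) ≠ 0 := by
    haveI := IwasawaLog.charZero p (F := K)
    have hm : (if p = 2 then 1 else 2 : ℕ) ≠ 0 := by split_ifs <;> decide
    exact_mod_cast hm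
  rw [hcast, mul_inv, mul_assoc, inv_mul_cancel_left₀ hmK]

/-- **"`O_v ⊂ I_v`" (LANA p. 26) for the real logarithm**: `𝒪_{K_v} = closedBall 0 1 ⊆ (2p)⁻¹ · log_p(𝒪^×_{K_v})`
— from [AbsTopIII] Def. 5.4 (iii) `𝒪_k ⊆ ℐ_k` (L3-t11/L4-t3 `closedBall_subset_logShell_ofUnitLog`, i.e. S1's
bijection `log_p : 1 + p*𝒪 ≅ p*𝒪`) and `ℐ ⊆ I_v`. [cite: LANA2026Report, §5.1 p. 26] -/
theorem closedBall_subset_logShellHF : closedBall (0 : K) 1 ⊆ logShellHF p K :=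
  (closedBall_subset_logShell_ofUnitLog p K).trans (logShell_ofUnitLog_subset_logShellHF p K)

/-- In particular `1 ∈ I_v`. [cite: LANA2026Report, §5.1 p. 26] -/
theorem one_mem_logShellHF : (1 : K) ∈ logShellHF p K :=
  closedBall_subset_logShellHF p K (by simp)

end IUTFork

end Summit.ABC

end
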